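import Summits.AtomisticToContinuum.HydrodynamicLimit.Theorems.OneFlightGossipEngineEnergyCurrentTailsPedigreeLedgerKinematics
import HarnessLib

/-!
# The lineage ledger, sure part: genuine kinematics, heir cascade, assembly
# (line `pedigree-perpetuity`, crux `EnergyCurrentTails`, stmt-AtomisticToContinuum-9235)

Lands the registered stub `stub_lineageLedgerSure : LineageLedgerSure` of the line (lead seat c3)
over `…PedigreeObjects` (vocabulary), `…PedigreeKinematics` (pair kinematics) and
`…PedigreeLedgerKinematics` (torus-trajectory facts, unfolding lemmas, clauses K0 / times / terminal
data).  Contents: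

* §1 clause (K) `genuine_kinematics`: at a genuine transition the impact vector is a unit vector, the
  post-velocities are the elastic reflection of the recorded pre-velocities (packet step
  `E_n ≤ s_n E^{proj}_n + q_n`, pair bound), and the next carrier's flight-start velocity is its
  recorded left-limit pre-velocity (`E_{n+1} = E^{proj}_n`);
* §2 clause (C), the HEIR CASCADE `∑_{i : seed i = j} w_{K*}(i) ≤ 1`, by a forest argument made
  index-free: for a particle `c` and a time `b` let the FLIGHT SUM `FS(c, b)` be the total weight
  `w_n(i)` of the lineage states `(i, n)`, `n ≤ K*(i)`, with carrier `c` whose flight started at `b`.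
  `FS(c, b) ≤ 1` by strong induction on the number of collision times in `(b, s)`: either no state
  with `n ≥ 1` sits on the flight — then only `(c, 0)` can — or the flight ends with a collision of `c`
  at some `e ∈ (b, s)` (unique: `c` is free on `(b, e)`), and every state `(i, n+1)` on it comes from
  a state `(i, n)` on `c`'s own flight into `e` (weight times `1 − cos²`) or on the partner's flight
  into `e` (weight times `cos²`) — the SAME `cos²` thanks to the antisymmetry of the separation at a
  collision (`sepVec_swap_of_mem_contactPairs`), so `FS(c, b) ≤ (1 − cos²)·1 + cos²·1 = 1`.  The root
  `FS(j, 0)` dominates the cascade sum (terminal states have flight start `0`);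
* §3 the assembly `stub_lineageLedgerSure` (valid for EVERY real `σ`: no smallness of the diameter is
  needed anywhere).

References: Gallagher–Saint-Raymond–Texier 2013 §4.1; Cercignani–Illner–Pulvirenti 1994 §4.2.
-/

noncomputable section

open Set Filter
open scoped InnerProductSpace BigOperators

namespace Summit.AtomisticToContinuum.HydrodynamicLimit.Theorems.EnergyCurrentTailsPedigree

open Literature.MathematicalPhysics.KineticTheory Literature.Analysis.FluidPDE

variable {N : ℕ} {ε : ℝ} {γ : ℝ → Config N (Fin 3) T3}

/-! ## §1 Clause (K): kinematics of a genuine transition -/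

/-- **Clause (K): kinematics of a genuine transition** — packet step, pair bound, identification
`E_{n+1} = E^{proj}_n`, and time decrease.  At the collision behind state `n` the impact vector is a
unit vector, the post-velocities are the elastic reflection of the recorded pre-velocities, and the
next carrier's flight-start velocity is its recorded (left-limit) pre-velocity. -/
theorem genuine_kinematics (h : IsHardSphereTrajectory (Torus.geometry (Fin 3)) ε N γ) (i : Fin N)
    {s : ℝ} {n : ℕ} (hg : Genuine ε γ i s n) :
    energy ε γ i s n ≤ share ε γ i s n * projEnergy ε γ i s n + quantum ε γ i s n
    ∧ energy ε γ i s n ≤ projEnergy ε γ i s n + quantum ε γ i s n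
    ∧ energy ε γ i s (n + 1) = projEnergy ε γ i s n
    ∧ ltime ε γ i s (n + 1) < ltime ε γ i s n := by
  obtain ⟨hmem, hlt⟩ := genuine_spec h i hg
  have ht0 : 0 < ltime ε γ i s (n + 1) := hg
  set t := ltime ε γ i s (n + 1) with ht
  set c := carrier ε γ i s n with hc
  set p := partner (Torus.geometry (Fin 3)) ε (γ t) c with hp
  have hcp : (c, p) ∈ contactPairs (Torus.geometry (Fin 3)) ε (γ t) :=
    torus_mk_partner_mem_contactPairs hmem
  obtain ⟨hne, hcontact⟩ := mem_contactPairs.1 hcp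
  have hε : 0 < ε := pos_of_mem_contactPairs h hcp
  have hR : brecord ε γ i s n
      = HardSphereCollisionRecord.ofConfig (Torus.geometry (Fin 3)) ε (γ t) t c p := rfl
  set ω := (brecord ε γ i s n).impactVec with hω
  set pre := (brecord ε γ i s n).preVel with hpre
  have hω1 : ‖ω‖ = 1 := by
    rw [hω, hR]
    exact HardSphereCollisionRecord.norm_ofConfig_impactVec hε t hcontact
  have hpost : reflectVel ω pre = ((γ t c).2, (γ t p).2) := by
    rw [hω, hpre, hR, HardSphereCollisionRecord.ofConfig_impactVec,
      HardSphereCollisionRecord.ofConfig_preVel, reflectVel_smul (inv_ne_zero hε.ne'),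
      reflectVel_reflectVel]
  have hE : energy ε γ i s n = ‖(reflectVel ω (pre.1, pre.2)).1‖ ^ 2 := by
    rw [Prod.mk.eta, hpost]
    rfl
  have hCS1 := inner_sq_le_norm_sq pre.1 ω hω1
  have hprojE : projEnergy ε γ i s n = max (‖pre.1‖ ^ 2) (‖pre.2‖ ^ 2) := rfl
  have hquant : quantum ε γ i s n = min (‖pre.1‖ ^ 2) (‖pre.2‖ ^ 2) := rfl
  have hshare : share ε γ i s n = if ‖pre.2‖ ≤ ‖pre.1‖ then 1 - ⟪pre.1, ω⟫_ℝ ^ 2 / ‖pre.1‖ ^ 2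
      else ⟪pre.2, ω⟫_ℝ ^ 2 / ‖pre.2‖ ^ 2 := rfl
  refine ⟨?_, ?_, ?_, hlt⟩
  · -- packet step
    rw [hE, hshare, hprojE, hquant]
    by_cases hcmp : ‖pre.2‖ ≤ ‖pre.1‖
    · have hsq : ‖pre.2‖ ^ 2 ≤ ‖pre.1‖ ^ 2 := pow_le_pow_left₀ (norm_nonneg _) hcmp 2
      rw [if_pos hcmp, max_eq_left hsq, min_eq_right hsq]
      have hid : (1 - ⟪pre.1, ω⟫_ℝ ^ 2 / ‖pre.1‖ ^ 2) * ‖pre.1‖ ^ 2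
          = ‖pre.1‖ ^ 2 - ⟪pre.1, ω⟫_ℝ ^ 2 := by
        by_cases h0 : ‖pre.1‖ ^ 2 = 0
        · have h00 : ⟪pre.1, ω⟫_ℝ ^ 2 = 0 := le_antisymm (h0 ▸ hCS1) (sq_nonneg _)
          rw [h0, h00]
          ring
        · rw [sub_mul, div_mul_cancel₀ _ h0, one_mul]
      rw [hid]
      exact packet_step_fst pre.1 pre.2 ω hω1
    · have hlt' : ‖pre.1‖ < ‖pre.2‖ := lt_of_not_ge hcmp
      have hsq : ‖pre.1‖ ^ 2 ≤ ‖pre.2‖ ^ 2 := pow_le_pow_left₀ (norm_nonneg _) hlt'.le 2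
      have hpos : 0 < ‖pre.2‖ ^ 2 := pow_pos ((norm_nonneg _).trans_lt hlt') 2
      rw [if_neg hcmp, max_eq_right hsq, min_eq_left hsq, div_mul_cancel₀ _ hpos.ne',
        norm_sq_reflectVel_fst pre.1 pre.2 ω hω1]
      linarith [sq_nonneg ⟪pre.1, ω⟫_ℝ]
  · -- pair bound
    rw [hE, hprojE, hquant, max_add_min]
    have hadd := norm_sq_reflectVel_add pre.1 pre.2 ω hω1
    linarith [sq_nonneg ‖(reflectVel ω (pre.1, pre.2)).2‖]
  · -- identification
    have hc' : carrier ε γ i s (n + 1) = if ‖pre.2‖ ≤ ‖pre.1‖ then c else p := carrier_succ ε γ i s n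
    have ha : ltime ε γ i s (n + 2)
        = flightStart (Torus.geometry (Fin 3)) ε γ 0 (carrier ε γ i s (n + 1)) t :=
      ltime_succ ε γ i s (n + 1)
    have hfin := h.finite_collisionTimesOf_inter_Ioo (carrier ε γ i s (n + 1)) 0 t
    have hat : ltime ε γ i s (n + 2) < t := by
      rw [ha]
      exact flightStart_lt hfin ht0
    have hleft : (Function.leftLim γ t (carrier ε γ i s (n + 1))).2
        = (γ (ltime ε γ i s (n + 2)) (carrier ε γ i s (n + 1))).2 :=
      leftLim_vel_eq_of_forall_not_participates h _ hat fun u hu =>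
        h.not_participates_of_mem_Ioo_flightStart (a := 0) (t := t) ⟨by rw [← ha]; exact hu.1, hu.2⟩
    have hpreL : pre = ((Function.leftLim γ t c).2, (Function.leftLim γ t p).2) := by
      rw [hpre, hR]
      exact h.ofConfig_preVel_eq_leftLim hcp
    have hE1 : energy ε γ i s (n + 1) = ‖(γ (ltime ε γ i s (n + 2)) (carrier ε γ i s (n + 1))).2‖ ^ 2 :=
      rfl
    rw [hE1, ← hleft, hprojE, hc']
    by_cases hcmp : ‖pre.2‖ ≤ ‖pre.1‖
    · rw [if_pos hcmp, max_eq_left (pow_le_pow_left₀ (norm_nonneg _) hcmp 2), hpreL]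
    · rw [if_neg hcmp, max_eq_right (pow_le_pow_left₀ (norm_nonneg _) (lt_of_not_ge hcmp).le 2), hpreL]


/-! ## §2 Clause (C): the heir cascade -/

open scoped Classical in
/-- The summands of the flight sums (the weight `w_n(i)` if state `(i, n)` has carrier `c` and flight
start `b`, else `0`) are nonnegative. -/
theorem smd_nonneg (ε : ℝ) (γ : ℝ → Config N (Fin 3) T3) (i : Fin N) (s : ℝ) (n : ℕ) (c : Fin N)
    (b : ℝ) : 0 ≤ (if carrier ε γ i s n = c ∧ ltime ε γ i s (n + 1) = b then weight ε γ i s n else 0) := by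
  split_ifs
  exacts [weight_nonneg ε γ i s n, le_rfl]

/-- **One genuine step seen from the next carrier.**  Let `c := c_{m+1}` (the projectile of the
collision at `e := τ_{m+1}`) and `R` the record of `(c, partner c)` at `e`.  Then `c` participates at
`e`, and EITHER the previous carrier was `c` itself (followed share `1 − cos²`) OR it was `c`'s partner
(share `cos²`) — the SAME `cos² = ⟪R.pre₁, R.ω⟫² / ‖R.pre₁‖²`: the record of the swapped pair has
swapped pre-velocities and the opposite impact vector (antisymmetry of the separation). -/
theorem genuine_step (h : IsHardSphereTrajectory (Torus.geometry (Fin 3)) ε N γ) (i : Fin N) {s : ℝ}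
    {m : ℕ} (hg : Genuine ε γ i s m) {e : ℝ} {c : Fin N} (hme : ltime ε γ i s (m + 1) = e)
    (hmc : carrier ε γ i s (m + 1) = c) (R : HardSphereCollisionRecord (Fin 3) T3 N)
    (hR : R = HardSphereCollisionRecord.ofConfig (Torus.geometry (Fin 3)) ε (γ e) e c
      (partner (Torus.geometry (Fin 3)) ε (γ e) c)) :
    Participates (Torus.geometry (Fin 3)) ε (γ e) c
    ∧ ((carrier ε γ i s m = c
          ∧ share ε γ i s m = 1 - ⟪R.preVel.1, R.impactVec⟫_ℝ ^ 2 / ‖R.preVel.1‖ ^ 2)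
      ∨ (carrier ε γ i s m = partner (Torus.geometry (Fin 3)) ε (γ e) c
          ∧ share ε γ i s m = ⟪R.preVel.1, R.impactVec⟫_ℝ ^ 2 / ‖R.preVel.1‖ ^ 2)) := by
  subst hR hme hmc
  obtain ⟨hmem, -⟩ := genuine_spec h i hg
  set e := ltime ε γ i s (m + 1) with he
  set c' := carrier ε γ i s m with hc'
  set p' := partner (Torus.geometry (Fin 3)) ε (γ e) c' with hp'
  have hcp : (c', p') ∈ contactPairs (Torus.geometry (Fin 3)) ε (γ e) :=
    torus_mk_partner_mem_contactPairs hmem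
  have hpc : partner (Torus.geometry (Fin 3)) ε (γ e) p' = c' := (h.partner_eq hcp).2
  have hRm : brecord ε γ i s m
      = HardSphereCollisionRecord.ofConfig (Torus.geometry (Fin 3)) ε (γ e) e c' p' := rfl
  have hsucc : carrier ε γ i s (m + 1)
      = if ‖(brecord ε γ i s m).preVel.2‖ ≤ ‖(brecord ε γ i s m).preVel.1‖ then c' else p' :=
    carrier_succ ε γ i s m
  by_cases hcond : ‖(brecord ε γ i s m).preVel.2‖ ≤ ‖(brecord ε γ i s m).preVel.1‖
  · rw [if_pos hcond] at hsucc
    rw [hsucc]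
    refine ⟨hmem, Or.inl ⟨rfl, ?_⟩⟩
    rw [share, if_pos hcond]
    rfl
  · rw [if_neg hcond] at hsucc
    rw [hsucc, hpc]
    refine ⟨⟨c', Or.inr hcp⟩, Or.inr ⟨rfl, ?_⟩⟩
    rw [share, if_neg hcond, hRm]
    have hanti := sepVec_swap_of_mem_contactPairs h hcp
    have hswap : reflectVel ((Torus.geometry (Fin 3)).sepVec (γ e c').1 (γ e p').1)
          ((γ e p').2, (γ e c').2)
        = ((reflectVel ((Torus.geometry (Fin 3)).sepVec (γ e c').1 (γ e p').1)
              ((γ e c').2, (γ e p').2)).2,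
           (reflectVel ((Torus.geometry (Fin 3)).sepVec (γ e c').1 (γ e p').1)
              ((γ e c').2, (γ e p').2)).1) :=
      reflectVel_swap _ ((γ e c').2, (γ e p').2)
    simp only [HardSphereCollisionRecord.ofConfig_preVel, HardSphereCollisionRecord.ofConfig_impactVec,
      hanti, reflectVel_neg, smul_neg, inner_neg_right, neg_sq, hswap]

/-- If `c`'s flights before `e` and before `e' > e > 0` start at the same time, then `c` has no
collision at `e` (it is free strictly between a flight start and the flight's end). -/
theorem not_participates_of_flightStart_eq (h : IsHardSphereTrajectory (Torus.geometry (Fin 3)) ε N γ)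
    {c : Fin N} {e e' : ℝ} (he : 0 < e) (hlt : e < e')
    (heq : flightStart (Torus.geometry (Fin 3)) ε γ 0 c e = flightStart (Torus.geometry (Fin 3)) ε γ 0 c e') :
    ¬ Participates (Torus.geometry (Fin 3)) ε (γ e) c := by
  refine h.not_participates_of_mem_Ioo_flightStart (a := 0) (k := c) (t := e') (u := e) ⟨?_, hlt⟩
  rw [← heq]
  exact flightStart_lt (h.finite_collisionTimesOf_inter_Ioo c 0 e) he

open scoped Classical in
/-- **Children of a flight.**  Fix the flight of `c` starting at `b = flightStart … c e` and ending with
a collision of `c` at `e > 0` (record `R` of `(c, partner c)`).  A lineage state `(i, n+1)` on this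
flight was reached from the state `(i, n)` on one of the two CHILD flights — `c`'s own flight into `e`
(weight times `1 − cos²`) or the partner's flight into `e` (weight times `cos²`); the collision time is
pinned to `e` because `c` is free on `(b, e)`. -/
theorem child_term_le (h : IsHardSphereTrajectory (Torus.geometry (Fin 3)) ε N γ) {s : ℝ} (hs : 0 < s)
    {c : Fin N} {b e : ℝ} (he : 0 < e) (hpart : Participates (Torus.geometry (Fin 3)) ε (γ e) c)
    (hb : flightStart (Torus.geometry (Fin 3)) ε γ 0 c e = b) (R : HardSphereCollisionRecord (Fin 3) T3 N)
    (hR : R = HardSphereCollisionRecord.ofConfig (Torus.geometry (Fin 3)) ε (γ e) e c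
      (partner (Torus.geometry (Fin 3)) ε (γ e) c)) (i : Fin N) {n : ℕ} (hn : n < termIndex ε γ i s) :
    (if carrier ε γ i s (n + 1) = c ∧ ltime ε γ i s (n + 2) = b then weight ε γ i s (n + 1) else 0)
      ≤ (1 - ⟪R.preVel.1, R.impactVec⟫_ℝ ^ 2 / ‖R.preVel.1‖ ^ 2)
          * (if carrier ε γ i s n = c ∧ ltime ε γ i s (n + 1) = e then weight ε γ i s n else 0)
        + ⟪R.preVel.1, R.impactVec⟫_ℝ ^ 2 / ‖R.preVel.1‖ ^ 2
          * (if carrier ε γ i s n = partner (Torus.geometry (Fin 3)) ε (γ e) c ∧ ltime ε γ i s (n + 1) = e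
              then weight ε γ i s n else 0) := by
  set X := ⟪R.preVel.1, R.impactVec⟫_ℝ ^ 2 / ‖R.preVel.1‖ ^ 2 with hXdef
  have hX : 0 ≤ X ∧ X ≤ 1 := by
    rw [hXdef, hR]
    exact inner_sq_div_mem (norm_impactVec_ofConfig_partner_le_one ε _ _ _) _
  have hA := smd_nonneg ε γ i s n c e
  have hB := smd_nonneg ε γ i s n (partner (Torus.geometry (Fin 3)) ε (γ e) c) e
  by_cases hcond : carrier ε γ i s (n + 1) = c ∧ ltime ε γ i s (n + 2) = b
  · obtain ⟨hc, hb'⟩ := hcond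
    rw [if_pos ⟨hc, hb'⟩]
    have hg : Genuine ε γ i s n := (termIndex_spec h i hs).2 n hn
    have hg0 : 0 < ltime ε γ i s (n + 1) := hg
    have hpart' : Participates (Torus.geometry (Fin 3)) ε (γ (ltime ε γ i s (n + 1))) c :=
      (genuine_step h i hg rfl hc _ rfl).1
    have hfs : flightStart (Torus.geometry (Fin 3)) ε γ 0 c (ltime ε γ i s (n + 1))
        = flightStart (Torus.geometry (Fin 3)) ε γ 0 c e := by
      have h2 : ltime ε γ i s (n + 2) = flightStart (Torus.geometry (Fin 3)) ε γ 0
          (carrier ε γ i s (n + 1)) (ltime ε γ i s (n + 1)) := ltime_succ ε γ i s (n + 1)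
      rw [hb, ← hb', h2, hc]
    have hen : ltime ε γ i s (n + 1) = e := by
      rcases lt_trichotomy (ltime ε γ i s (n + 1)) e with hlt | heq | hgt
      · exact absurd hpart' (not_participates_of_flightStart_eq h hg0 hlt hfs)
      · exact heq
      · exact absurd hpart (not_participates_of_flightStart_eq h he hgt hfs.symm)
    rw [weight_succ]
    rcases (genuine_step h i hg hen hc R hR).2 with ⟨hcar, hsh⟩ | ⟨hcar, hsh⟩
    · rw [if_pos ⟨hcar, hen⟩, hsh]
      calc weight ε γ i s n * (1 - X) = (1 - X) * weight ε γ i s n + X * 0 := by ring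
        _ ≤ _ := add_le_add le_rfl (mul_le_mul_of_nonneg_left hB hX.1)
    · rw [if_pos (show carrier ε γ i s n = partner (Torus.geometry (Fin 3)) ε (γ e) c
        ∧ ltime ε γ i s (n + 1) = e from ⟨hcar, hen⟩), hsh]
      calc weight ε γ i s n * X = (1 - X) * 0 + X * weight ε γ i s n := by ring
        _ ≤ _ := add_le_add (mul_le_mul_of_nonneg_left hA (sub_nonneg.2 hX.2)) le_rfl
  · rw [if_neg hcond]
    exact add_nonneg (mul_nonneg (sub_nonneg.2 hX.2) hA) (mul_nonneg hX.1 hB)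

open scoped Classical in
/-- **The flight sums are at most one.**  For every particle `c` and start time `b`, the total weight
of the lineage states `(i, n)`, `n ≤ K*(i)`, sitting on the flight `(c, b)` is at most `1` (strong
induction on the number of collision times in `(b, s)`; see the module docstring). -/
theorem flightSum_le_one (h : IsHardSphereTrajectory (Torus.geometry (Fin 3)) ε N γ) {s : ℝ} (hs : 0 < s)
    (m : ℕ) : ∀ (c : Fin N) (b : ℝ), (collisionTimes (Torus.geometry (Fin 3)) ε γ ∩ Ioo b s).ncard = m →
      (∑ i, ∑ n ∈ Finset.range (termIndex ε γ i s + 1),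
        if carrier ε γ i s n = c ∧ ltime ε γ i s (n + 1) = b then weight ε γ i s n else 0) ≤ 1 := by
  induction m using Nat.strong_induction_on with
  | _ m ih =>
  intro c b hm
  have hsplit : ∀ i : Fin N, (∑ n ∈ Finset.range (termIndex ε γ i s + 1),
        if carrier ε γ i s n = c ∧ ltime ε γ i s (n + 1) = b then weight ε γ i s n else 0)
      = (∑ n ∈ Finset.range (termIndex ε γ i s),
          if carrier ε γ i s (n + 1) = c ∧ ltime ε γ i s (n + 2) = b then weight ε γ i s (n + 1) else 0)
        + (if i = c ∧ ltime ε γ i s 1 = b then 1 else 0) := fun i => by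
    rw [Finset.sum_range_succ', carrier_zero, weight_zero]
  rw [Finset.sum_congr rfl fun i _ => hsplit i, Finset.sum_add_distrib,
    Finset.sum_eq_single_of_mem c (Finset.mem_univ c) fun i _ hic => if_neg fun hh => hic hh.1]
  simp only [true_and]
  by_cases hex : ∃ i n, n < termIndex ε γ i s ∧ carrier ε γ i s (n + 1) = c ∧ ltime ε γ i s (n + 2) = b
  · -- the flight ends with a collision of `c` at `e := τ_{n₀+1}(i₀) ∈ (b, s)`
    obtain ⟨i₀, n₀, hn₀, hc₀, hb₀⟩ := hex
    have hg₀ : Genuine ε γ i₀ s n₀ := (termIndex_spec h i₀ hs).2 n₀ hn₀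
    set e := ltime ε γ i₀ s (n₀ + 1) with he_def
    set R := HardSphereCollisionRecord.ofConfig (Torus.geometry (Fin 3)) ε (γ e) e c
      (partner (Torus.geometry (Fin 3)) ε (γ e) c) with hR
    have hpart : Participates (Torus.geometry (Fin 3)) ε (γ e) c := (genuine_step h i₀ hg₀ rfl hc₀ R hR).1
    have he0 : 0 < e := hg₀
    have hes : e < s := (genuine_spec h i₀ hg₀).2.trans_le (ltime_le h i₀ hs n₀)
    have hbe : flightStart (Torus.geometry (Fin 3)) ε γ 0 c e = b := by
      have h2 : ltime ε γ i₀ s (n₀ + 2) = flightStart (Torus.geometry (Fin 3)) ε γ 0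
          (carrier ε γ i₀ s (n₀ + 1)) (ltime ε γ i₀ s (n₀ + 1)) := ltime_succ ε γ i₀ s (n₀ + 1)
      rw [← hb₀, h2, hc₀]
    have hblt : b < e := by
      rw [← hbe]
      exact flightStart_lt (h.finite_collisionTimesOf_inter_Ioo c 0 _) he0
    -- the flight is not `c`'s terminal flight: the `n = 0` term vanishes
    have hT0 : ¬ ltime ε γ c s 1 = b := fun h1 =>
      not_participates_of_flightStart_eq h he0 hes (hbe.trans h1.symm) hpart
    rw [if_neg hT0, add_zero]
    -- induction hypothesis at `e` for the two child flights
    have hcard : (collisionTimes (Torus.geometry (Fin 3)) ε γ ∩ Ioo e s).ncard < m := by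
      rw [← hm]
      refine Set.ncard_lt_ncard ⟨inter_subset_inter_right _ (Ioo_subset_Ioo hblt.le le_rfl),
        fun hsub => ?_⟩ ((h.locFinite b s).subset (inter_subset_inter_right _ Ioo_subset_Icc_self))
      exact lt_irrefl _ (hsub ⟨collisionTimesOf_subset γ c hpart, hblt, hes⟩).2.1
    have hmono : ∀ c' : Fin N, (∑ i, ∑ n ∈ Finset.range (termIndex ε γ i s),
        if carrier ε γ i s n = c' ∧ ltime ε γ i s (n + 1) = e then weight ε γ i s n else 0) ≤ 1 :=
      fun c' => (Finset.sum_le_sum fun i _ => Finset.sum_le_sum_of_subset_of_nonneg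
        (Finset.range_subset_range.2 (Nat.le_succ _)) fun n _ _ => smd_nonneg ε γ i s n c' _).trans
          (ih _ hcard c' _ rfl)
    set X := ⟪R.preVel.1, R.impactVec⟫_ℝ ^ 2 / ‖R.preVel.1‖ ^ 2 with hXdef
    have hX : 0 ≤ X ∧ X ≤ 1 := by
      rw [hXdef, hR]
      exact inner_sq_div_mem (norm_impactVec_ofConfig_partner_le_one ε _ _ _) _
    refine (Finset.sum_le_sum fun i _ => Finset.sum_le_sum fun n hn =>
      child_term_le h hs he0 hpart hbe R hR i (Finset.mem_range.1 hn)).trans ?_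
    simp only [Finset.sum_add_distrib, ← Finset.mul_sum]
    calc _ ≤ (1 - X) * 1 + X * 1 :=
        add_le_add (mul_le_mul_of_nonneg_left (hmono c) (sub_nonneg.2 hX.2))
          (mul_le_mul_of_nonneg_left (hmono _) hX.1)
      _ = 1 := by ring
  · -- no state with `n ≥ 1` sits on the flight
    rw [Finset.sum_eq_zero fun i _ => Finset.sum_eq_zero fun n hn =>
      if_neg fun hh => hex ⟨i, n, Finset.mem_range.1 hn, hh⟩, zero_add]
    split_ifs
    exacts [le_rfl, zero_le_one]

/-- **Clause (C): the heir cascade.**  For every seed `j`, the terminal weights of the particles whose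
lineage ends at `j` sum to at most `1` (they sit on the root flight `(j, 0)`). -/
theorem heirCascade (h : IsHardSphereTrajectory (Torus.geometry (Fin 3)) ε N γ) {s : ℝ} (hs : 0 < s)
    (j : Fin N) :
    (∑ i ∈ (Finset.univ.filter fun i : Fin N => termCarrier ε γ i s = j), termWeight ε γ i s) ≤ 1 := by
  classical
  refine le_trans ?_ (flightSum_le_one h hs _ j 0 rfl)
  rw [Finset.sum_filter]
  refine Finset.sum_le_sum fun i _ => ?_
  split_ifs with hij
  · refine (Finset.single_le_sum
      (f := fun n => if carrier ε γ i s n = j ∧ ltime ε γ i s (n + 1) = 0 then weight ε γ i s n else 0)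
      (fun n _ => smd_nonneg ε γ i s n j 0) (Finset.self_mem_range_succ (termIndex ε γ i s))).trans'
      (le_of_eq ?_)
    exact (if_pos ⟨hij, ltime_termIndex_succ h i hs⟩).symm
  · exact Finset.sum_nonneg fun n _ => smd_nonneg ε γ i s n j 0

/-! ## §3 Assembly of the registered stub -/

/-- **LINEAGE LEDGER, SURE PART** (registered stub `stub_lineageLedgerSure` of the line
`pedigree-perpetuity`): clauses (K0), (K), times, terminal energy, `E_0`, energy cap and the heir
cascade (C), on the good set of every hard-sphere flow of the crux frame — for EVERY real `σ`. -/
theorem stub_lineageLedgerSure : LineageLedgerSure := by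
  intro σ N Φ
  refine ⟨fun z hz i s hs => ?_, fun z hz s hs j => heirCascade (Φ.isTrajectory z hz) hs j⟩
  have h := Φ.isTrajectory z hz
  refine ⟨fun n => share_mem _ _ i s n, fun n hg => genuine_kinematics h i hg,
    fun n => ltime_succ_nonneg h i s n, fun n hg => ?_, exists_not_genuine h i hs, ?_,
    fun hnp => energy_zero_of_not_participates h i hs hnp, fun n => ?_⟩
  · by_contra hn
    exact not_genuine_succ i hn hg
  · rw [energy_termIndex h i hs]
    simp only [Φ.flow_zero z hz]
  · refine (energy_le_total h i s n).trans_eq ?_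
    simp only [Φ.flow_zero z hz]

end Summit.AtomisticToContinuum.HydrodynamicLimit.Theorems.EnergyCurrentTailsPedigree

end
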